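import Literature.Computability.AlgebraicComplexity.BurgisserKrickPardoShape
import Literature.RingTheory.ZeroDimensional.AffineBezoutCount
import HarnessLib

/-!
# Bürgisser's Theorem 4.5: the Bézout input discharged

Topic `Literature/Computability/AlgebraicComplexity`; companion of `BurgisserKrickPardoShape.lean`,
which proves ingredient (B) of Bürgisser 2000 TCS, Thm. 4.5 (Krick–Pardo's shape lemma with
heights, the hypothesis `hB` of `algebraicSolution_height_bound_of_ingredients`) from
zero-dimensional Bézout (`hBez`) and the heights of the points (`hHt`). Zero-dimensional Bézout is
now a theorem of the tree (`Literature.RingTheory.ZeroDimensional.ncard_zeroSet_le_pow_int`,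
`AffineBezoutCount.lean`, from the Philippon-type projective count of
`Literature.RingTheory.MvPolynomial.card_le_pow_of_relevant_minimalPrimes`), so (B), Thm. 4.5 and
the target fact `PPoly_eq_polyAdvice_NP_of_VP_eq_VNP k` rest on (A) (Lemmas 4.3–4.4) and the point
heights alone:

* `krickPardo_shape_of_pointHeights` — (B) from `hHt`;
* `algebraicSolution_height_bound_of_zeroDimReduction_of_pointHeights` — Thm. 4.5 from (A) + `hHt`;
* `PPoly_eq_polyAdvice_NP_of_VP_eq_VNP_of_zeroDimReduction_of_pointHeights` — the target from
  (A) + `hHt` (GRH prime ideal theorem, Cor. 4.8, Thm. 4.1, (A2), (A3) being proved in the tree).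

## References

* P. Bürgisser, *Cook's versus Valiant's hypothesis*, TCS 235 (2000) 71–88, Thm. 4.5, p. 82, and
  Cor. 1.2(1), p. 74. [Burgisser2000TCS]
* J. Heintz, TCS 24 (1983), Thm. 2 (Bézout inequality); Bürgisser–Clausen–Shokrollahi (1997),
  Thm. 8.28. [BurgisserClausenShokrollahi1997]
-/

noncomputable section

open scoped Classical
open Polynomial

namespace Literature.Computability.AlgebraicComplexity

/-- **Ingredient (B) of Thm. 4.5 from the point heights alone** (Bürgisser 2000 TCS, p. 82,
Krick–Pardo [18, Prop. 27] + Lemma 2.4): zero-dimensional Bézout being proved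
(`ncard_zeroSet_le_pow_int`), the hypothesis `hB` of `algebraicSolution_height_bound_of_ingredients`
follows from the bound `hHt` on the heights of the coordinates of the points.
[cite: Burgisser2000TCS, proof of Thm. 4.5 p. 82] -/
theorem krickPardo_shape_of_pointHeights
    (hHt : ∃ c₀ : ℕ, ∀ (n d W : ℕ) (F : Fin n → MvPolynomial (Fin n) ℤ), n < d → 2 ≤ W →
      (∀ i, (F i).totalDegree ≤ d) → (∀ i, weight (F i) ≤ W) →
      {z : Fin n → ℂ | ∀ i, MvPolynomial.aeval z (F i) = 0}.Finite →
      ∀ z : Fin n → ℂ, (∀ i, MvPolynomial.aeval z (F i) = 0) → ∀ j, ∃ P : ℤ[X], P ≠ 0 ∧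
        aeval (z j) P = 0 ∧ Real.log (polyWeight P) ≤ c₀ * (d : ℝ) ^ (c₀ * n) * Real.log W) :
    ∃ c : ℕ, ∀ (n d W : ℕ) (F : Fin n → MvPolynomial (Fin n) ℤ),
      n < d → 2 ≤ W → (∀ i, (F i).totalDegree ≤ d) → (∀ i, weight (F i) ≤ W) →
      {z : Fin n → ℂ | ∀ i, MvPolynomial.aeval z (F i) = 0}.Finite →
      ∃ (ℓ : Fin n → ℤ) (lam : ℕ) (v : Fin n → Polynomial ℤ), 0 < lam ∧
        (∀ z : Fin n → ℂ, (∀ i, MvPolynomial.aeval z (F i) = 0) →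
          ∀ j, z j = (lam : ℂ)⁻¹ * Polynomial.aeval (∑ k, (ℓ k : ℂ) * z k) (v j)) ∧
        (∀ j, (v j).natDegree ≤ c * d ^ (c * n)) ∧
        Real.log lam ≤ c * (d : ℝ) ^ (c * n) * Real.log W ∧
        ∀ j, Real.log (polyWeight (v j)) ≤ c * (d : ℝ) ^ (c * n) * Real.log W :=
  krickPardo_shape_of_bezout_of_pointHeights
    (fun n d F hdeg hfin =>
      Literature.RingTheory.ZeroDimensional.ncard_zeroSet_le_pow_int n d F hdeg hfin) hHt

/-- **Theorem 4.5 from (A) and the point heights** (Bürgisser 2000 TCS, Thm. 4.5): the named fact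
`algebraicSolution_height_bound` follows from the zero-dimensional reduction with small weight
(Lemmas 4.3–4.4, hypothesis `hA` of `algebraicSolution_height_bound_of_ingredients`) and the bound
`hHt` on the heights of the coordinates of the points of a finite complete intersection; Bézout,
the shape lemma with its heights, Mignotte and the rest of the printed proof are theorems of the
tree. [cite: Burgisser2000TCS, Thm. 4.5 and its proof p. 82] -/
theorem algebraicSolution_height_bound_of_zeroDimReduction_of_pointHeights
    (hA : ∀ (n s d w : ℕ) (S : Fin s → MvPolynomial (Fin n) ℤ),
      n < d → 1 ≤ w → (∀ i, (S i).totalDegree ≤ d) → (∀ i, weight (S i) ≤ w) →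
      (∃ z : Fin n → ℂ, ∀ i, MvPolynomial.aeval z (S i) = 0) →
      ∃ F : Fin n → MvPolynomial (Fin n) ℤ,
        (∀ i, (F i).totalDegree ≤ d) ∧ (∀ i, weight (F i) ≤ w * d ^ (2 * n)) ∧
        {z : Fin n → ℂ | ∀ i, MvPolynomial.aeval z (F i) = 0}.Finite ∧
        ∃ z : Fin n → ℂ, (∀ i, MvPolynomial.aeval z (F i) = 0) ∧
          ∀ i, MvPolynomial.aeval z (S i) = 0)
    (hHt : ∃ c₀ : ℕ, ∀ (n d W : ℕ) (F : Fin n → MvPolynomial (Fin n) ℤ), n < d → 2 ≤ W →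
      (∀ i, (F i).totalDegree ≤ d) → (∀ i, weight (F i) ≤ W) →
      {z : Fin n → ℂ | ∀ i, MvPolynomial.aeval z (F i) = 0}.Finite →
      ∀ z : Fin n → ℂ, (∀ i, MvPolynomial.aeval z (F i) = 0) → ∀ j, ∃ P : ℤ[X], P ≠ 0 ∧
        aeval (z j) P = 0 ∧ Real.log (polyWeight P) ≤ c₀ * (d : ℝ) ^ (c₀ * n) * Real.log W) :
    algebraicSolution_height_bound :=
  algebraicSolution_height_bound_of_ingredients hA (krickPardo_shape_of_pointHeights hHt)

/-- **The target fact from (A) and the point heights.** Bürgisser's Cor. 1.2(1),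
`VP_k = VNP_k ⟹ P/poly = NP/poly` under GRH in characteristic zero (the named fact
`PPoly_eq_polyAdvice_NP_of_VP_eq_VNP k`), follows from the zero-dimensional reduction (A) and the
point-height bound; everything else in the printed proof (GRH prime ideal theorem, Cor. 4.8,
Thm. 4.1, Bézout, the shape lemma with heights, (A2), (A3)) is proved in the tree.
[cite: Burgisser2000TCS, Cor. 1.2(1) p. 74 and Thm. 4.5 p. 82] -/
theorem PPoly_eq_polyAdvice_NP_of_VP_eq_VNP_of_zeroDimReduction_of_pointHeights
    (k : Type) [Field k]
    (hA : ∀ (n s d w : ℕ) (S : Fin s → MvPolynomial (Fin n) ℤ),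
      n < d → 1 ≤ w → (∀ i, (S i).totalDegree ≤ d) → (∀ i, weight (S i) ≤ w) →
      (∃ z : Fin n → ℂ, ∀ i, MvPolynomial.aeval z (S i) = 0) →
      ∃ F : Fin n → MvPolynomial (Fin n) ℤ,
        (∀ i, (F i).totalDegree ≤ d) ∧ (∀ i, weight (F i) ≤ w * d ^ (2 * n)) ∧
        {z : Fin n → ℂ | ∀ i, MvPolynomial.aeval z (F i) = 0}.Finite ∧
        ∃ z : Fin n → ℂ, (∀ i, MvPolynomial.aeval z (F i) = 0) ∧
          ∀ i, MvPolynomial.aeval z (S i) = 0)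
    (hHt : ∃ c₀ : ℕ, ∀ (n d W : ℕ) (F : Fin n → MvPolynomial (Fin n) ℤ), n < d → 2 ≤ W →
      (∀ i, (F i).totalDegree ≤ d) → (∀ i, weight (F i) ≤ W) →
      {z : Fin n → ℂ | ∀ i, MvPolynomial.aeval z (F i) = 0}.Finite →
      ∀ z : Fin n → ℂ, (∀ i, MvPolynomial.aeval z (F i) = 0) → ∀ j, ∃ P : ℤ[X], P ≠ 0 ∧
        aeval (z j) P = 0 ∧ Real.log (polyWeight P) ≤ c₀ * (d : ℝ) ^ (c₀ * n) * Real.log W) :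
    PPoly_eq_polyAdvice_NP_of_VP_eq_VNP k :=
  PPoly_eq_polyAdvice_NP_of_VP_eq_VNP_of_heightBound k
    (algebraicSolution_height_bound_of_zeroDimReduction_of_pointHeights hA hHt)

end Literature.Computability.AlgebraicComplexity

end
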